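import Summits.Ventures.PercRepro.ThetaSigmaStrict

/-!
# (Σ) and (Σ⁺) on three points, in the kernel

Dossier proofs/MINE1-theoremS.md, Addendum 76 (mine-1, gen 39). On a ground set of three points
there are `2^8 = 256` families of subsets; `decide` checks Conjecture (Σ) and its strict form
(Σ⁺) (at least three members, no extreme member) for all of them.
-/

namespace PercRepro.MSTight

set_option maxRecDepth 100000 in
/-- **(Σ) on three points.** -/
theorem conjSigma_fin3 : ConjSigma (Fin 3) := by
  unfold ConjSigma SigmaValidRel
  decide

set_option maxRecDepth 100000 in
/-- **(Σ⁺) on three points**: every valid instance with at least three members and no extreme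
member is strict. -/
theorem conjSigmaStrict_fin3 :
    ∀ X : Finset (Finset (Fin 3)), SigmaValidRel Finset.univ X → 3 ≤ X.card → ∅ ∉ X →
      Finset.univ ∉ X → X.card < (sigmaD Finset.univ X).card := by
  unfold SigmaValidRel
  decide

end PercRepro.MSTight
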